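import Summits.ValiantsHypothesis.ValiantsHypothesis.Theorems.KPlusLogSqLawTropicalBStaticFourSigns

/-!
# `TropicalB` (stmt-ValiantsHypothesis-19771) — the static `4 × 4` cell: the conditions (D) and (H) HOLD for dominant permutations

Cell `pub-symmetroid`, seat val-sym-trop-p4 (g7).  HONEST FRAMING: second half of the interpretation of the sign checker
(`…StaticFourSignCheckerDefs` / `…StaticFourSignChecker`, p524484 / p525054; first half `…StaticFourSigns`: cell indicators, table facts,
literal dictionary, static terms).  For a STATIC `4 × 4` design: a dominant diagonal of a quad satisfies `diagCond` (`diag_holds`, from DIAGONAL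
BRACKETING, p522470), a dominant parity class of a `3 × 3` block satisfies `hexCond` (`hex_holds`, from the PARITY-CLASS LAW), hence every
condition of `condsOf V` holds for any indicator `V` of permutations carried by dominant chain terms, with the (transitive) block-exchange vector
of the cell slopes: `conds_hold`.  With `rep_contradiction`: no static `4 × 4` design has `16` dominant permutations forming one of the `14` orbit
representatives; the orbit cover and the assembly are the next files.  Nothing here bears on `TropicalB` in its window, `WeakLifting`,
`MatrixDescartes` (stmt-ValiantsHypothesis-18050) or VP ≠ VNP.
[this seat]
-/

set_option linter.dupNamespace false
set_option autoImplicit false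

namespace Summit.ValiantsHypothesis.ValiantsHypothesis.Theorems.KPlusLogSqLaw.StaticFourQuad

open Summit.ValiantsHypothesis.ValiantsHypothesis.Theorems.MatrixDescartes.Negative
open Summit.ValiantsHypothesis.ValiantsHypothesis.Theorems.LacunarySymmetroidMatrixDescartes
open Summit.ValiantsHypothesis.ValiantsHypothesis.Theorems.LacunarySymmetroidMatrixDescartes.TropicalCensus
open Finset

section Design

variable {K : ℕ} (d : Fin K → ℕ) (v : Fin 4 → Fin 4 → Fin K → ℤ) {ε : Fin 4 → Fin 4 → Fin K → ℤ} {cls : Fin 4 → Fin 4 → Fin K}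

/-! ### 4. The conditions hold -/

/-- **(D) holds**: a dominant diagonal `s, t` of a quad with hidden corners `h, h'` satisfies `diagCond s t h h'`. -/
theorem diag_holds (hcls : ∀ r i l, ε r i l ≠ 0 → ε r i (cls r i) ≠ 0) {s t h h' : Fin 24}
    (hcell : ∀ r i, ind s r i + ind t r i = ind h r i + ind h' r i)
    (hcov : ∀ i, (rowOf h i = rowOf s i ∨ rowOf h i = rowOf t i) ∧ (rowOf h' i = rowOf s i ∨ rowOf h' i = rowOf t i))
    (hne : h ≠ s ∧ h ≠ t ∧ h' ≠ s ∧ h' ≠ t)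
    (hlit : LitOK s h ∧ LitOK s h' ∧ LitOK h t ∧ LitOK h' t ∧ LitOK t h ∧ LitOK t h' ∧ LitOK h s ∧ LitOK h' s)
    {θs θt : ℤ} (hθ : θs ≠ θt) (ds : IsDominant d v ε θs (sterm cls s)) (dt : IsDominant d v ε θt (sterm cls t)) :
    CondHolds (ev (aOf d cls)) (diagCond s t h h') := by
  -- presence of the hidden corners
  have cs := cells_present (ε := ε) ds.1 (s := s) rfl
  have ct := cells_present (ε := ε) dt.1 (s := t) rfl
  have ph : termSign ε (sterm cls h) ≠ 0 := sterm_present hcls fun i => by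
    rcases (hcov i).1 with e | e <;> rw [e]
    exacts [cs i, ct i]
  have ph' : termSign ε (sterm cls h') ≠ 0 := sterm_present hcls fun i => by
    rcases (hcov i).2 with e | e <;> rw [e]
    exacts [cs i, ct i]
  -- the parallelogram identity of weights
  have hpar : ∀ θ : ℤ, tropWeight d v θ (sterm cls s) + tropWeight d v θ (sterm cls t) =
      tropWeight d v θ (sterm cls h) + tropWeight d v θ (sterm cls h') := by
    intro θ
    simp only [sterm_weight]
    have hx := sum_cells_two (aOf d cls) hcell
    have hy := sum_cells_two (fun r i => v r i (cls r i)) hcell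
    unfold xv at *; unfold yv
    linear_combination θ * hx - hy
  obtain ⟨h1, h2, h3, h4⟩ := hne
  obtain ⟨l1, l2, l3, l4, l5, l6, l7, l8⟩ := hlit
  set a := aOf d cls
  rcases lt_or_gt_of_ne hθ with hlt | hlt
  · obtain ⟨b1, b2, b3, b4⟩ := Bracketing.slope_bracket d v ε hlt hpar (sterm_ne cls h1) (sterm_ne cls h2) (sterm_ne cls h3)
      (sterm_ne cls h4) ph ph' ds dt
    simp only [sterm_slope] at b1 b2 b3 b4
    refine ⟨_, List.mem_cons_self, branchHolds_of fun l hl => ?_⟩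
    simp only [List.mem_cons, List.not_mem_nil, or_false] at hl
    rcases hl with rfl | rfl | rfl | rfl
    exacts [lit_holds a l1 b1, lit_holds a l2 b3, lit_holds a l3 b2, lit_holds a l4 b4]
  · have hpar' : ∀ θ : ℤ, tropWeight d v θ (sterm cls t) + tropWeight d v θ (sterm cls s) =
        tropWeight d v θ (sterm cls h) + tropWeight d v θ (sterm cls h') := fun θ => by rw [add_comm]; exact hpar θ
    obtain ⟨b1, b2, b3, b4⟩ := Bracketing.slope_bracket d v ε hlt hpar' (sterm_ne cls h2) (sterm_ne cls h1) (sterm_ne cls h4)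
      (sterm_ne cls h3) ph ph' dt ds
    simp only [sterm_slope] at b1 b2 b3 b4
    refine ⟨_, List.mem_cons_of_mem _ List.mem_cons_self, branchHolds_of fun l hl => ?_⟩
    simp only [List.mem_cons, List.not_mem_nil, or_false] at hl
    rcases hl with rfl | rfl | rfl | rfl
    exacts [lit_holds a l5 b1, lit_holds a l6 b3, lit_holds a l7 b2, lit_holds a l8 b4]

/-- **(H), sorted core**: with `f₁, f₂, f₃` dominant at `θ₁ < θ₂ < θ₃` and the other class `o₁, o₂, o₃` present with the weight identity,
either `f₁` is below every `o` or `f₃` is above every `o` (in slope). -/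
theorem hex_core {f₁ f₂ f₃ o₁ o₂ o₃ : Fin 24}
    (hsum : ∀ θ : ℤ, tropWeight d v θ (sterm cls f₁) + tropWeight d v θ (sterm cls f₂) + tropWeight d v θ (sterm cls f₃) =
      tropWeight d v θ (sterm cls o₁) + tropWeight d v θ (sterm cls o₂) + tropWeight d v θ (sterm cls o₃))
    (po : termSign ε (sterm cls o₁) ≠ 0 ∧ termSign ε (sterm cls o₂) ≠ 0 ∧ termSign ε (sterm cls o₃) ≠ 0)
    (hne : ∀ o ∈ [o₁, o₂, o₃], o ≠ f₁ ∧ o ≠ f₂ ∧ o ≠ f₃) (h13 : f₁ ≠ f₃)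
    {θ₁ θ₂ θ₃ : ℤ} (h12 : θ₁ < θ₂) (h23 : θ₂ < θ₃)
    (d₁ : IsDominant d v ε θ₁ (sterm cls f₁)) (d₂ : IsDominant d v ε θ₂ (sterm cls f₂)) (d₃ : IsDominant d v ε θ₃ (sterm cls f₃)) :
    (∀ o ∈ [o₁, o₂, o₃], xv (aOf d cls) f₁ < xv (aOf d cls) o) ∨ (∀ o ∈ [o₁, o₂, o₃], xv (aOf d cls) o < xv (aOf d cls) f₃) := by
  set a := aOf d cls
  have s13 : xv a f₁ < xv a f₃ := by
    have := TropicalCensus.slope_lt_of_dominant d v ε (h12.trans h23) (sterm_ne cls h13) d₁ d₃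
    simpa only [sterm_slope] using this
  -- the key: no `o` at or below `f₁` together with an `o'` at or above `f₃`
  have key : ∀ o ∈ [o₁, o₂, o₃], ∀ o' ∈ [o₁, o₂, o₃], xv a o ≤ xv a f₁ → xv a f₃ ≤ xv a o' → False := by
    intro o ho o' ho' hlo hhi
    obtain ⟨p1, p2, p3⟩ := po
    -- `o = o'` is impossible by `s13`; otherwise apply the parity-class law with the third element
    have main : ∀ {x y z : Fin 24}, (∀ θ : ℤ, tropWeight d v θ (sterm cls f₁) + tropWeight d v θ (sterm cls f₂) +
        tropWeight d v θ (sterm cls f₃) = tropWeight d v θ (sterm cls x) + tropWeight d v θ (sterm cls y) + tropWeight d v θ (sterm cls z)) →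
        termSign ε (sterm cls x) ≠ 0 → termSign ε (sterm cls y) ≠ 0 → termSign ε (sterm cls z) ≠ 0 →
        x ≠ f₁ → y ≠ f₃ → z ≠ f₂ → xv a x ≤ xv a f₁ → xv a f₃ ≤ xv a y → False := by
      intro x y z hs px py pz hx hy hz hxle hyle
      refine Bracketing.parity_class_not_majorized d v ε h12 h23 hs px py pz (sterm_ne cls hx) (sterm_ne cls hy)
        (sterm_ne cls hz) d₁ d₂ d₃ ?_ ?_
      · simpa only [sterm_slope] using hxle
      · simpa only [sterm_slope] using hyle
    simp only [List.mem_cons, List.not_mem_nil, or_false] at ho ho'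
    have n1 := hne o₁ (by simp); have n2 := hne o₂ (by simp); have n3 := hne o₃ (by simp)
    rcases ho with rfl | rfl | rfl <;> rcases ho' with rfl | rfl | rfl
    · linarith
    · exact main (z := o₃) (fun θ => by linarith [hsum θ]) p1 p2 p3 n1.1 n2.2.2 n3.2.1 hlo hhi
    · exact main (z := o₂) (fun θ => by linarith [hsum θ]) p1 p3 p2 n1.1 n3.2.2 n2.2.1 hlo hhi
    · exact main (z := o₃) (fun θ => by linarith [hsum θ]) p2 p1 p3 n2.1 n1.2.2 n3.2.1 hlo hhi
    · linarith
    · exact main (z := o₁) (fun θ => by linarith [hsum θ]) p2 p3 p1 n2.1 n3.2.2 n1.2.1 hlo hhi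
    · exact main (z := o₂) (fun θ => by linarith [hsum θ]) p3 p1 p2 n3.1 n1.2.2 n2.2.1 hlo hhi
    · exact main (z := o₁) (fun θ => by linarith [hsum θ]) p3 p2 p1 n3.1 n2.2.2 n1.2.1 hlo hhi
    · linarith
  by_cases hall : ∀ o ∈ [o₁, o₂, o₃], xv a f₁ < xv a o
  · exact Or.inl hall
  · right
    push Not at hall
    obtain ⟨o, ho, hlo⟩ := hall
    intro o' ho'
    by_contra hc
    push Not at hc
    exact key o ho o' ho' hlo hc

/-- a «below» branch holds. -/
theorem below_branch (a : Fin 4 → Fin 4 → ℤ) {e o₁ o₂ o₃ : Fin 24} (l1 : LitOK e o₁) (l2 : LitOK e o₂) (l3 : LitOK e o₃)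
    (h : ∀ o ∈ [o₁, o₂, o₃], xv a e < xv a o) : BranchHolds (ev a) [lit e o₁, lit e o₂, lit e o₃] := by
  intro l hl
  simp only [List.mem_cons, List.not_mem_nil, or_false] at hl
  rcases hl with rfl | rfl | rfl
  exacts [lit_holds a l1 (h o₁ (by simp)), lit_holds a l2 (h o₂ (by simp)), lit_holds a l3 (h o₃ (by simp))]

/-- an «above» branch holds. -/
theorem above_branch (a : Fin 4 → Fin 4 → ℤ) {e o₁ o₂ o₃ : Fin 24} (l1 : LitOK o₁ e) (l2 : LitOK o₂ e) (l3 : LitOK o₃ e)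
    (h : ∀ o ∈ [o₁, o₂, o₃], xv a o < xv a e) : BranchHolds (ev a) [lit o₁ e, lit o₂ e, lit o₃ e] := by
  intro l hl
  simp only [List.mem_cons, List.not_mem_nil, or_false] at hl
  rcases hl with rfl | rfl | rfl
  exacts [lit_holds a l1 (h o₁ (by simp)), lit_holds a l2 (h o₂ (by simp)), lit_holds a l3 (h o₃ (by simp))]

/-- **(H) holds**: a dominant parity class `e₁, e₂, e₃` of a `3 × 3` block (other class `o₁, o₂, o₃`) satisfies `hexCond e₁ e₂ e₃ o₁ o₂ o₃`. -/
theorem hex_holds (hcls : ∀ r i l, ε r i l ≠ 0 → ε r i (cls r i) ≠ 0) {e₁ e₂ e₃ o₁ o₂ o₃ : Fin 24}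
    (hcell : ∀ r i, ind e₁ r i + ind e₂ r i + ind e₃ r i = ind o₁ r i + ind o₂ r i + ind o₃ r i)
    (hcov : ∀ i, (rowOf o₁ i = rowOf e₁ i ∨ rowOf o₁ i = rowOf e₂ i ∨ rowOf o₁ i = rowOf e₃ i) ∧
      (rowOf o₂ i = rowOf e₁ i ∨ rowOf o₂ i = rowOf e₂ i ∨ rowOf o₂ i = rowOf e₃ i) ∧
      (rowOf o₃ i = rowOf e₁ i ∨ rowOf o₃ i = rowOf e₂ i ∨ rowOf o₃ i = rowOf e₃ i))
    (hne : e₁ ≠ e₂ ∧ e₁ ≠ e₃ ∧ e₂ ≠ e₃ ∧ o₁ ≠ e₁ ∧ o₁ ≠ e₂ ∧ o₁ ≠ e₃ ∧ o₂ ≠ e₁ ∧ o₂ ≠ e₂ ∧ o₂ ≠ e₃ ∧ o₃ ≠ e₁ ∧ o₃ ≠ e₂ ∧ o₃ ≠ e₃)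
    (hlit : LitOK e₁ o₁ ∧ LitOK e₁ o₂ ∧ LitOK e₁ o₃ ∧ LitOK e₂ o₁ ∧ LitOK e₂ o₂ ∧ LitOK e₂ o₃ ∧ LitOK e₃ o₁ ∧ LitOK e₃ o₂ ∧ LitOK e₃ o₃ ∧
      LitOK o₁ e₁ ∧ LitOK o₂ e₁ ∧ LitOK o₃ e₁ ∧ LitOK o₁ e₂ ∧ LitOK o₂ e₂ ∧ LitOK o₃ e₂ ∧ LitOK o₁ e₃ ∧ LitOK o₂ e₃ ∧ LitOK o₃ e₃)
    {t₁ t₂ t₃ : ℤ} (ht : t₁ ≠ t₂ ∧ t₁ ≠ t₃ ∧ t₂ ≠ t₃)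
    (d₁ : IsDominant d v ε t₁ (sterm cls e₁)) (d₂ : IsDominant d v ε t₂ (sterm cls e₂)) (d₃ : IsDominant d v ε t₃ (sterm cls e₃)) :
    CondHolds (ev (aOf d cls)) (hexCond e₁ e₂ e₃ o₁ o₂ o₃) := by
  set a := aOf d cls
  -- presence of the other class
  have c1 := cells_present (ε := ε) d₁.1 (s := e₁) rfl
  have c2 := cells_present (ε := ε) d₂.1 (s := e₂) rfl
  have c3 := cells_present (ε := ε) d₃.1 (s := e₃) rfl
  have po : termSign ε (sterm cls o₁) ≠ 0 ∧ termSign ε (sterm cls o₂) ≠ 0 ∧ termSign ε (sterm cls o₃) ≠ 0 := by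
    refine ⟨sterm_present hcls fun i => ?_, sterm_present hcls fun i => ?_, sterm_present hcls fun i => ?_⟩
    · rcases (hcov i).1 with e | e | e <;> rw [e]
      exacts [c1 i, c2 i, c3 i]
    · rcases (hcov i).2.1 with e | e | e <;> rw [e]
      exacts [c1 i, c2 i, c3 i]
    · rcases (hcov i).2.2 with e | e | e <;> rw [e]
      exacts [c1 i, c2 i, c3 i]
  -- the weight identity
  have hsum : ∀ θ : ℤ, tropWeight d v θ (sterm cls e₁) + tropWeight d v θ (sterm cls e₂) + tropWeight d v θ (sterm cls e₃) =
      tropWeight d v θ (sterm cls o₁) + tropWeight d v θ (sterm cls o₂) + tropWeight d v θ (sterm cls o₃) := by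
    intro θ
    simp only [sterm_weight]
    have hx := sum_cells_three (aOf d cls) hcell
    have hy := sum_cells_three (fun r i => v r i (cls r i)) hcell
    unfold xv at *; unfold yv
    linear_combination θ * hx - hy
  obtain ⟨n12, n13, n23, m11, m12, m13, m21, m22, m23, m31, m32, m33⟩ := hne
  obtain ⟨l11, l12, l13, l21, l22, l23, l31, l32, l33, k11, k21, k31, k12, k22, k32, k13, k23, k33⟩ := hlit
  have hneO : ∀ o ∈ [o₁, o₂, o₃], o ≠ e₁ ∧ o ≠ e₂ ∧ o ≠ e₃ := by
    intro o ho
    simp only [List.mem_cons, List.not_mem_nil, or_false] at ho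
    rcases ho with rfl | rfl | rfl
    exacts [⟨m11, m12, m13⟩, ⟨m21, m22, m23⟩, ⟨m31, m32, m33⟩]
  -- branches of `hexCond`
  have B1 : ∀ {br}, br ∈ hexCond e₁ e₂ e₃ o₁ o₂ o₃ → BranchHolds (ev a) br → CondHolds (ev a) (hexCond e₁ e₂ e₃ o₁ o₂ o₃) :=
    fun hm hb => ⟨_, hm, hb⟩
  have mem1 : [lit e₁ o₁, lit e₁ o₂, lit e₁ o₃] ∈ hexCond e₁ e₂ e₃ o₁ o₂ o₃ := by simp [hexCond]
  have mem2 : [lit e₂ o₁, lit e₂ o₂, lit e₂ o₃] ∈ hexCond e₁ e₂ e₃ o₁ o₂ o₃ := by simp [hexCond]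
  have mem3 : [lit e₃ o₁, lit e₃ o₂, lit e₃ o₃] ∈ hexCond e₁ e₂ e₃ o₁ o₂ o₃ := by simp [hexCond]
  have mem4 : [lit o₁ e₁, lit o₂ e₁, lit o₃ e₁] ∈ hexCond e₁ e₂ e₃ o₁ o₂ o₃ := by simp [hexCond]
  have mem5 : [lit o₁ e₂, lit o₂ e₂, lit o₃ e₂] ∈ hexCond e₁ e₂ e₃ o₁ o₂ o₃ := by simp [hexCond]
  have mem6 : [lit o₁ e₃, lit o₂ e₃, lit o₃ e₃] ∈ hexCond e₁ e₂ e₃ o₁ o₂ o₃ := by simp [hexCond]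
  have S1 : ∀ θ : ℤ, tropWeight d v θ (sterm cls e₁) + tropWeight d v θ (sterm cls e₃) + tropWeight d v θ (sterm cls e₂) =
      tropWeight d v θ (sterm cls o₁) + tropWeight d v θ (sterm cls o₂) + tropWeight d v θ (sterm cls o₃) := fun θ => by linarith [hsum θ]
  have S2 : ∀ θ : ℤ, tropWeight d v θ (sterm cls e₂) + tropWeight d v θ (sterm cls e₁) + tropWeight d v θ (sterm cls e₃) =
      tropWeight d v θ (sterm cls o₁) + tropWeight d v θ (sterm cls o₂) + tropWeight d v θ (sterm cls o₃) := fun θ => by linarith [hsum θ]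
  have S3 : ∀ θ : ℤ, tropWeight d v θ (sterm cls e₂) + tropWeight d v θ (sterm cls e₃) + tropWeight d v θ (sterm cls e₁) =
      tropWeight d v θ (sterm cls o₁) + tropWeight d v θ (sterm cls o₂) + tropWeight d v θ (sterm cls o₃) := fun θ => by linarith [hsum θ]
  have S4 : ∀ θ : ℤ, tropWeight d v θ (sterm cls e₃) + tropWeight d v θ (sterm cls e₁) + tropWeight d v θ (sterm cls e₂) =
      tropWeight d v θ (sterm cls o₁) + tropWeight d v θ (sterm cls o₂) + tropWeight d v θ (sterm cls o₃) := fun θ => by linarith [hsum θ]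
  have S5 : ∀ θ : ℤ, tropWeight d v θ (sterm cls e₃) + tropWeight d v θ (sterm cls e₂) + tropWeight d v θ (sterm cls e₁) =
      tropWeight d v θ (sterm cls o₁) + tropWeight d v θ (sterm cls o₂) + tropWeight d v θ (sterm cls o₃) := fun θ => by linarith [hsum θ]
  have P1 := fun o ho => let h := hneO o ho; (⟨h.1, h.2.2, h.2.1⟩ : o ≠ e₁ ∧ o ≠ e₃ ∧ o ≠ e₂)
  have P2 := fun o ho => let h := hneO o ho; (⟨h.2.1, h.1, h.2.2⟩ : o ≠ e₂ ∧ o ≠ e₁ ∧ o ≠ e₃)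
  have P3 := fun o ho => let h := hneO o ho; (⟨h.2.1, h.2.2, h.1⟩ : o ≠ e₂ ∧ o ≠ e₃ ∧ o ≠ e₁)
  have P4 := fun o ho => let h := hneO o ho; (⟨h.2.2, h.1, h.2.1⟩ : o ≠ e₃ ∧ o ≠ e₁ ∧ o ≠ e₂)
  have P5 := fun o ho => let h := hneO o ho; (⟨h.2.2, h.2.1, h.1⟩ : o ≠ e₃ ∧ o ≠ e₂ ∧ o ≠ e₁)
  obtain ⟨t12, t13, t23⟩ := ht
  rcases lt_or_gt_of_ne t12 with a12 | a21 <;> rcases lt_or_gt_of_ne t13 with a13 | a31 <;> rcases lt_or_gt_of_ne t23 with a23 | a32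
  · -- e₁ < e₂ < e₃
    rcases hex_core d v hsum po hneO n13 a12 a23 d₁ d₂ d₃ with h | h
    exacts [B1 mem1 (below_branch a l11 l12 l13 h), B1 mem6 (above_branch a k13 k23 k33 h)]
  · -- e₁ < e₃ < e₂
    rcases hex_core d v S1 po P1 n12 a13 a32 d₁ d₃ d₂ with h | h
    exacts [B1 mem1 (below_branch a l11 l12 l13 h), B1 mem5 (above_branch a k12 k22 k32 h)]
  · exact absurd (a12.trans a23) (lt_asymm a31)
  · -- e₃ < e₁ < e₂
    rcases hex_core d v S4 po P4 n23.symm a31 a12 d₃ d₁ d₂ with h | h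
    exacts [B1 mem3 (below_branch a l31 l32 l33 h), B1 mem5 (above_branch a k12 k22 k32 h)]
  · -- e₂ < e₁ < e₃
    rcases hex_core d v S2 po P2 n23 a21 a13 d₂ d₁ d₃ with h | h
    exacts [B1 mem2 (below_branch a l21 l22 l23 h), B1 mem6 (above_branch a k13 k23 k33 h)]
  · exact absurd (a21.trans a13) (lt_asymm a32)
  · -- e₂ < e₃ < e₁
    rcases hex_core d v S3 po P3 n12.symm a23 a31 d₂ d₃ d₁ with h | h
    exacts [B1 mem2 (below_branch a l21 l22 l23 h), B1 mem4 (above_branch a k11 k21 k31 h)]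
  · -- e₃ < e₂ < e₁
    rcases hex_core d v S5 po P5 n13.symm a32 a21 d₃ d₂ d₁ with h | h
    exacts [B1 mem3 (below_branch a l31 l32 l33 h), B1 mem4 (above_branch a k11 k21 k31 h)]

/-! ### 5. Main theorem: the conditions of any set of dominant permutations hold -/

/-- **INTERPRETATION THEOREM.**  For a static `4 × 4` design, a family `p` of dominant terms (at slopes `θ k`), and any indicator `V` of
permutation indices carried by chain terms, there is an integer vector of block exchanges (that of the cell slopes `d ∘ class`) satisfying
the triple laws and every condition of `condsOf V`. -/
theorem conds_hold (hs : IsStatic ε) {n : ℕ} (θ : Fin (n + 1) → ℤ) (p : Fin (n + 1) → Equiv.Perm (Fin 4) × (Fin 4 → Fin K))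
    (hdom : ∀ k, IsDominant d v ε (θ k) (p k))
    (V : Fin 24 → Bool) (hV : ∀ s, V s = true → ∃ k, (p k).1 = P24 s) :
    ∃ e : Fin 36 → ℤ, Trans e ∧ ∀ c ∈ condsOf V, CondHolds e c := by
  classical
  -- a class table hitting a present class wherever there is one
  have l₀ : Fin K := (p 0).2 0
  have hex : ∀ r i : Fin 4, ∃ l : Fin K, ∀ l', ε r i l' ≠ 0 → ε r i l ≠ 0 := by
    intro r i
    by_cases h : ∃ l', ε r i l' ≠ 0
    · obtain ⟨l', hl'⟩ := h
      exact ⟨l', fun _ _ => hl'⟩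
    · exact ⟨l₀, fun l' hl' => absurd ⟨l', hl'⟩ h⟩
  choose cls hcls' using hex
  have hcls : ∀ r i l, ε r i l ≠ 0 → ε r i (cls r i) ≠ 0 := fun r i l h => hcls' r i l h
  refine ⟨ev (aOf d cls), trans_ev _, fun c hc => ?_⟩
  -- dominant indices carry `sterm cls`
  have hD : ∀ s, V s = true → ∃ k, IsDominant d v ε (θ k) (sterm cls s) := by
    intro s hsV
    obtain ⟨k, hk⟩ := hV s hsV
    refine ⟨k, ?_⟩
    rw [← eq_sterm hs hcls (hdom k).1 hk]
    exact hdom k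
  have hθne : ∀ {s t : Fin 24} {ks kt : Fin (n + 1)}, s ≠ t → IsDominant d v ε (θ ks) (sterm cls s) →
      IsDominant d v ε (θ kt) (sterm cls t) → θ ks ≠ θ kt := by
    intro s t ks kt hst hks hkt heq
    rw [heq] at hks
    refine sterm_ne cls hst ?_
    by_contra hne'
    exact lt_irrefl _ ((hks.2 _ (Ne.symm hne') hkt.1).trans (hkt.2 _ hne' hks.1))
  simp only [condsOf, List.mem_append, List.mem_flatMap] at hc
  rcases hc with ⟨q, hq, hc⟩ | ⟨h, hh, hc⟩
  · obtain ⟨hcell, hcov, hne, hlit⟩ := quad_facts q hq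
    obtain ⟨n01, n02, n03, n12, n13, n23⟩ := hne
    obtain ⟨l1, l2, l3, l4, l5, l6, l7, l8⟩ := hlit
    simp only [List.mem_ite_nil_right, List.mem_singleton, Bool.and_eq_true] at hc
    rcases hc with ⟨⟨hv0, hv3⟩, rfl⟩ | ⟨⟨hv1, hv2⟩, rfl⟩
    · obtain ⟨k0, d0⟩ := hD _ hv0
      obtain ⟨k3, d3⟩ := hD _ hv3
      exact diag_holds d v hcls hcell (fun i => ⟨(hcov i).1, (hcov i).2.1⟩) ⟨n01.symm, n13, n02.symm, n23⟩
        ⟨l1, l2, l3, l4, l5, l6, l7, l8⟩ (hθne n03 d0 d3) d0 d3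
    · obtain ⟨k1, d1⟩ := hD _ hv1
      obtain ⟨k2, d2⟩ := hD _ hv2
      exact diag_holds d v hcls (fun r i => by linarith [hcell r i]) (fun i => ⟨(hcov i).2.2.1, (hcov i).2.2.2⟩)
        ⟨n01, n02, n13.symm, n23.symm⟩ ⟨l7, l3, l2, l6, l8, l4, l1, l5⟩ (hθne n12 d1 d2) d1 d2
  · obtain ⟨hcell, hcov, hne, hlit⟩ := hex_facts h hh
    obtain ⟨a12, a13, a23, b12, b13, b23, m11, m12, m13, m21, m22, m23, m31, m32, m33⟩ := hne
    obtain ⟨l11, l12, l13, l21, l22, l23, l31, l32, l33, k11, k21, k31, k12, k22, k32, k13, k23, k33⟩ := hlit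
    simp only [List.mem_ite_nil_right, List.mem_singleton, Bool.and_eq_true] at hc
    rcases hc with ⟨⟨⟨hv1, hv2⟩, hv3⟩, rfl⟩ | ⟨⟨⟨hv1, hv2⟩, hv3⟩, rfl⟩
    · obtain ⟨k1, d1⟩ := hD _ hv1
      obtain ⟨k2, d2⟩ := hD _ hv2
      obtain ⟨k3, d3⟩ := hD _ hv3
      exact hex_holds d v hcls hcell (fun i => ⟨(hcov i).1, (hcov i).2.1, (hcov i).2.2.1⟩)
        ⟨a12, a13, a23, m11.symm, m21.symm, m31.symm, m12.symm, m22.symm, m32.symm, m13.symm, m23.symm, m33.symm⟩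
        ⟨l11, l12, l13, l21, l22, l23, l31, l32, l33, k11, k21, k31, k12, k22, k32, k13, k23, k33⟩
        ⟨hθne a12 d1 d2, hθne a13 d1 d3, hθne a23 d2 d3⟩ d1 d2 d3
    · obtain ⟨k1, d1⟩ := hD _ hv1
      obtain ⟨k2, d2⟩ := hD _ hv2
      obtain ⟨k3, d3⟩ := hD _ hv3
      exact hex_holds d v hcls (fun r i => (hcell r i).symm) (fun i => ⟨(hcov i).2.2.2.1, (hcov i).2.2.2.2.1, (hcov i).2.2.2.2.2⟩)
        ⟨b12, b13, b23, m11, m12, m13, m21, m22, m23, m31, m32, m33⟩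
        ⟨k11, k12, k13, k21, k22, k23, k31, k32, k33, l11, l21, l31, l12, l22, l32, l13, l23, l33⟩
        ⟨hθne b12 d1 d2, hθne b13 d1 d3, hθne b23 d2 d3⟩ d1 d2 d3

end Design

end Summit.ValiantsHypothesis.ValiantsHypothesis.Theorems.KPlusLogSqLaw.StaticFourQuad
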